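import Summits.NavierStokesRegularity.NavierStokesRegularity.Theorems.PerpetualPumpPumpTransferVolterraLocal
import HarnessLib

/-!
# `PerpetualPump.PumpTransfer` (stmt-NavierStokesRegularity-1837), line `Sketch`, stub `stub_volterra_maximal`

Registered stub of the lead's skeleton `Cruxes/PumpTransfer/Lines/Sketch.lean` (lead prover
prover-line-stmt-NavierStokesRegularity-1837-0). Riskless local theory of the LIFTED VOLTERRA SYSTEM of the cascade
equation (3.3): uniqueness on every `[0,S)` and the maximal-solution / blow-up alternative.

Vocabulary: Tao's cascade operator (4.1) with wavelet data `𝒟 : CascadeWaveletData ε₀ m`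
(`Literature/Analysis/FluidPDE/TaoCascadeOperator.lean`), the heat fibres `duhamelScalar δ Qr L t`,
weights `modeWeight 𝒟 i n = |ψ̂_{i,n}|²` and `modeDelta` (`TaoCascadeDuhamel.lean`), `heatRate ξ = 4π²|ξ|²`
(`TaoBandHeatGroup.lean`), the circuit nonlinearity `TaoCascade.quadTerm` (`TaoCascadeODE.lean`).

## The argument

The Picard step `stub_volterra_local`, the gluing lemmas `volterra_glue`/`continuousOn_glue` and the energy bound
`abs_le_of_sol` (`|X_{i,n}| ≤ |A|`, from the cancellation (4.3) through the band field of the landed synthesis stubs)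
are the helper file `PerpetualPumpPumpTransferVolterraLocal.lean`; the estimates and uniqueness `volterra_unique` are
`Literature/Analysis/FluidPDE/TaoCascadeVolterraEstimates.lean`, `TaoCascadeDuhamelRestart.lean`. Here:

* (U) is `volterra_unique` on `[0,t]` for every `t < S`.
* (M): let `𝒮 = {T ≥ 0 : a solution with a weighted bound exists on [0,T]}` (`0 ∈ 𝒮`, down-closed, and
  `T ∈ 𝒮 ⇒ T+τ ∈ 𝒮` by the Picard step). If `𝒮` is unbounded, glue on `I = [0,∞)` (`σ(s) = s+1`) and clamp time at `0`.
  Otherwise `S = sup 𝒮 > 0`, glue on `[0,S)` (`σ(s) = (s+S)/2`); by the energy bound every `Q_{i,n}` is bounded on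
  `[0,S)`, so each `X_{i,n}` is Lipschitz there (`lipschitzOnWith_integral_duhamelScalar_modeWeight`) and extends
  continuously to `ℝ` (McShane); a weighted bound up to `S` would let the Picard step pass `S`. Finally
  `1 + N¹⁰ ≤ (1+N²)⁵`.

## References

* T. Tao, J. Amer. Math. Soc. 29 (2016), 601–674 = arXiv:1402.0290v3, §4 Lemma 4.1 (4.14). [`Tao2016AveragedNS`]
-/

noncomputable section

-- the nested summit namespace is the tree's layout (D-0017)
set_option linter.dupNamespace false

namespace Summit.NavierStokesRegularity.NavierStokesRegularity.Theorems.PerpetualPumpPumpTransfer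

open MeasureTheory Set Filter Topology
open scoped ENNReal NNReal SchwartzMap
open Literature.Analysis Literature.Analysis.FluidPDE Literature.Analysis.FluidPDE.Tao2016

variable {ε₀ : ℝ} {m : ℕ}

/-! ### The stub -/

-- the assembly is long: the default heartbeat budget is too small
set_option maxHeartbeats 1600000 in
/-- **Stub `stub_volterra_maximal`.** Uniqueness (U) and the maximal-solution alternative (M) for the lifted Volterra
system `X_{i,n}(t) = ∫ duhamelScalar (A·1_{(i,n)=(i₀,n₀)}) (quadTerm_{i,n}(X) ∘ max · 0) (4π²|ξ|²) t · |ψ̂_{i,n}(ξ)|² dξ`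
with the a-priori weighted bound on compact sub-intervals (module docstring). [cite: Tao2016AveragedNS, §4 Lemma 4.1 (4.14)] -/
theorem stub_volterra_maximal :
    ∀ (ε₀ : ℝ), 0 < ε₀ → ε₀ < 1 → ∀ (m : ℕ) (𝒟 : CascadeWaveletData ε₀ m)
    (α : Fin m → Fin m → Fin m → ℤ × ℤ × ℤ → ℝ), TaoCascade.IsSymmetricCoeff α → TaoCascade.IsCancellingCoeff α →
    ∀ (i₀ : Fin m) (n₀ : ℤ) (A : ℝ),
    (∀ (S : ℝ) (X Y : Fin m → ℤ → ℝ → ℝ),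
      (∀ (i : Fin m) (n : ℤ), Continuous (X i n)) →
      (∀ (i : Fin m) (n : ℤ), ∀ t ∈ Ico (0 : ℝ) S,
        X i n t = ∫ ξ : EuclideanSpace ℝ (Fin 3),
          duhamelScalar (A * modeDelta i₀ i n₀ n)
            (fun s => TaoCascade.quadTerm ε₀ α X i n (max s 0)) (heatRate ξ) t * modeWeight 𝒟 i n ξ) →
      (∀ S' ∈ Ico (0 : ℝ) S, ∃ C : ℝ, ∀ (i : Fin m) (n : ℤ), ∀ t ∈ Icc (0 : ℝ) S',
        (1 + ((1 + ε₀) ^ n) ^ 10) * |X i n t| ≤ C) →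
      (∀ (i : Fin m) (n : ℤ), Continuous (Y i n)) →
      (∀ (i : Fin m) (n : ℤ), ∀ t ∈ Ico (0 : ℝ) S,
        Y i n t = ∫ ξ : EuclideanSpace ℝ (Fin 3),
          duhamelScalar (A * modeDelta i₀ i n₀ n)
            (fun s => TaoCascade.quadTerm ε₀ α Y i n (max s 0)) (heatRate ξ) t * modeWeight 𝒟 i n ξ) →
      (∀ S' ∈ Ico (0 : ℝ) S, ∃ C : ℝ, ∀ (i : Fin m) (n : ℤ), ∀ t ∈ Icc (0 : ℝ) S',
        (1 + ((1 + ε₀) ^ n) ^ 10) * |Y i n t| ≤ C) →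
      ∀ (i : Fin m) (n : ℤ), ∀ t ∈ Ico (0 : ℝ) S, X i n t = Y i n t) ∧
    ((∃ X : Fin m → ℤ → ℝ → ℝ,
        (∀ (i : Fin m) (n : ℤ), Continuous (X i n)) ∧
        (∀ (i : Fin m) (n : ℤ), ∀ t ∈ Ici (0 : ℝ),
          X i n t = ∫ ξ : EuclideanSpace ℝ (Fin 3),
            duhamelScalar (A * modeDelta i₀ i n₀ n)
              (fun s => TaoCascade.quadTerm ε₀ α X i n (max s 0)) (heatRate ξ) t * modeWeight 𝒟 i n ξ) ∧
        (∀ S' ∈ Ici (0 : ℝ), ∃ C : ℝ, ∀ (i : Fin m) (n : ℤ), ∀ t ∈ Icc (0 : ℝ) S',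
          (1 + ((1 + ε₀) ^ n) ^ 10) * |X i n t| ≤ C)) ∨
     (∃ S : ℝ, 0 < S ∧ ∃ X : Fin m → ℤ → ℝ → ℝ,
        (∀ (i : Fin m) (n : ℤ), Continuous (X i n)) ∧
        (∀ (i : Fin m) (n : ℤ), ∀ t ∈ Ico (0 : ℝ) S,
          X i n t = ∫ ξ : EuclideanSpace ℝ (Fin 3),
            duhamelScalar (A * modeDelta i₀ i n₀ n)
              (fun s => TaoCascade.quadTerm ε₀ α X i n (max s 0)) (heatRate ξ) t * modeWeight 𝒟 i n ξ) ∧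
        (∀ S' ∈ Ico (0 : ℝ) S, ∃ C : ℝ, ∀ (i : Fin m) (n : ℤ), ∀ t ∈ Icc (0 : ℝ) S',
          (1 + ((1 + ε₀) ^ n) ^ 10) * |X i n t| ≤ C) ∧
        (∀ C : ℝ, ∃ t ∈ Ico (0 : ℝ) S, ∃ (i : Fin m) (n : ℤ),
          C < (1 + ((1 + ε₀) ^ n) ^ 2) ^ 5 * |X i n t|))) := by
  intro ε₀ hε₀ hε₁ m 𝒟 α _hsymm hcanc i₀ n₀ A
  have hε : 0 < 1 + ε₀ := by linarith
  have hw0 : ∀ k : ℤ, 0 < 1 + ((1 + ε₀) ^ k) ^ 10 := fun k => by positivity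
  set K : ℝ := (∑ i₃ : Fin m, ∑ i₁ : Fin m, ∑ i₂ : Fin m, ∑ μ ∈ TaoCascade.shiftSet, |α i₁ i₂ i₃ μ|) with hK
  have hK0 : 0 ≤ K := by positivity
  refine ⟨fun S X Y hXc hXV hXB hYc hYV hYB i n t ht => ?_, ?_⟩
  · -- (U)
    obtain ⟨CX, hCX⟩ := hXB t ht
    obtain ⟨CY, hCY⟩ := hYB t ht
    exact volterra_unique hε₀ hε₁ 𝒟 α i₀ n₀ A (C := max CX CY) hXc hYc (fun j k r hr => hXV j k r ⟨hr.1, hr.2.trans_lt ht.2⟩)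
      (fun j k r hr => hYV j k r ⟨hr.1, hr.2.trans_lt ht.2⟩) (fun j k r hr => (hCX j k r hr).trans (le_max_left _ _))
      (fun j k r hr => (hCY j k r hr).trans (le_max_right _ _)) i n t ⟨ht.1, le_rfl⟩
  -- (M): the set of existence times
  set 𝒮 : Set ℝ := {T | 0 ≤ T ∧ ∃ X : Fin m → ℤ → ℝ → ℝ, (∀ (i : Fin m) (n : ℤ), Continuous (X i n)) ∧
    (∀ (i : Fin m) (n : ℤ), ∀ t ∈ Icc (0 : ℝ) T, X i n t = ∫ ξ : EuclideanSpace ℝ (Fin 3),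
      duhamelScalar (A * modeDelta i₀ i n₀ n) (fun s => TaoCascade.quadTerm ε₀ α X i n (max s 0)) (heatRate ξ) t *
        modeWeight 𝒟 i n ξ) ∧
    ∃ C : ℝ, ∀ (i : Fin m) (n : ℤ), ∀ t ∈ Icc (0 : ℝ) T, (1 + ((1 + ε₀) ^ n) ^ 10) * |X i n t| ≤ C} with h𝒮
  -- the constant datum solves the system on `[0,0]`
  have hδB : ∀ (i : Fin m) (n : ℤ), (1 + ((1 + ε₀) ^ n) ^ 10) * |A * modeDelta i₀ i n₀ n| ≤ (1 + ((1 + ε₀) ^ n₀) ^ 10) * |A| := by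
    intro i n
    unfold modeDelta
    split_ifs with hh
    · rw [← hh.2, mul_one]
    · rw [mul_zero, abs_zero, mul_zero]; positivity
  have hV0 : ∀ (i : Fin m) (n : ℤ), ∀ t ∈ Icc (0 : ℝ) 0, A * modeDelta i₀ i n₀ n = ∫ ξ : EuclideanSpace ℝ (Fin 3),
      duhamelScalar (A * modeDelta i₀ i n₀ n) (fun s => TaoCascade.quadTerm ε₀ α (fun i n _ => A * modeDelta i₀ i n₀ n) i n
        (max s 0)) (heatRate ξ) t * modeWeight 𝒟 i n ξ := by
    intro i n t ht
    rw [le_antisymm ht.2 ht.1]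
    simp only [duhamelScalar_zero, integral_const_mul, integral_modeWeight hε, mul_one]
  have h0 : (0 : ℝ) ∈ 𝒮 := ⟨le_rfl, fun i n _ => A * modeDelta i₀ i n₀ n, fun _ _ => continuous_const, hV0,
    (1 + ((1 + ε₀) ^ n₀) ^ 10) * |A|, fun i n t _ => hδB i n⟩
  have hdown : ∀ T ∈ 𝒮, ∀ T' ∈ Icc (0 : ℝ) T, T' ∈ 𝒮 := fun T ⟨_, X, hXc, hXV, C, hXC⟩ T' hT' =>
    ⟨hT'.1, X, hXc, fun i n t ht => hXV i n t ⟨ht.1, ht.2.trans hT'.2⟩, C, fun i n t ht => hXC i n t ⟨ht.1, ht.2.trans hT'.2⟩⟩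
  -- the Picard step inside `𝒮`
  have hstep : ∀ (T B R τ : ℝ) (Xo : Fin m → ℤ → ℝ → ℝ), 0 ≤ T → (∀ (i : Fin m) (n : ℤ), Continuous (Xo i n)) →
      (∀ (i : Fin m) (n : ℤ), ∀ t ∈ Icc (0 : ℝ) T, Xo i n t = ∫ ξ : EuclideanSpace ℝ (Fin 3),
        duhamelScalar (A * modeDelta i₀ i n₀ n) (fun s => TaoCascade.quadTerm ε₀ α Xo i n (max s 0)) (heatRate ξ) t *
          modeWeight 𝒟 i n ξ) →
      (∀ (i : Fin m) (n : ℤ), ∀ t ∈ Icc (0 : ℝ) T, (1 + ((1 + ε₀) ^ n) ^ 10) * |Xo i n t| ≤ B) →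
      B + (1 + ((1 + ε₀) ^ n₀) ^ 10) * |A| + 2 ^ 22 * K * T * B ^ 2 + 1 ≤ R → 0 < τ → τ * (2 ^ 23 * K * R ^ 2) ≤ 1 →
      T + τ ∈ 𝒮 := by
    intro T B R τ Xo hT hXc hXV hXB hR hτ hτR
    obtain ⟨X, hXc', hXV', hXB'⟩ := stub_volterra_local ε₀ hε₀ hε₁ m 𝒟 α i₀ n₀ A T B R τ Xo hT hXc hXV hXB hR hτ hτR
    exact ⟨by linarith, X, hXc', hXV', R, hXB'⟩
  -- a first step from `T = 0`
  set R₀ : ℝ := 2 * ((1 + ((1 + ε₀) ^ n₀) ^ 10) * |A|) + 1 with hR₀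
  set τ₀ : ℝ := 1 / (2 ^ 23 * K * R₀ ^ 2 + 1) with hτ₀
  have hτ₀0 : 0 < τ₀ := by positivity
  have hτ₀𝒮 : τ₀ ∈ 𝒮 := by
    have h := hstep 0 ((1 + ((1 + ε₀) ^ n₀) ^ 10) * |A|) R₀ τ₀ (fun i n _ => A * modeDelta i₀ i n₀ n) le_rfl
      (fun _ _ => continuous_const) hV0 (fun i n t _ => hδB i n) (by rw [hR₀]; ring_nf; exact le_rfl) hτ₀0
      (by rw [hτ₀, div_mul_eq_mul_div, one_mul, div_le_one (by positivity)]; linarith)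
    rwa [zero_add] at h
  by_cases hbdd : BddAbove 𝒮
  · -- (M2) a finite maximal time `S = sup 𝒮`
    right
    set S : ℝ := sSup 𝒮 with hSdef
    have hS0 : 0 < S := hτ₀0.trans_le (le_csSup hbdd hτ₀𝒮)
    have hmem : ∀ T : ℝ, ∃ X : Fin m → ℤ → ℝ → ℝ, (0 ≤ T ∧ T < S) → (∀ (i : Fin m) (n : ℤ), Continuous (X i n)) ∧
        (∀ (i : Fin m) (n : ℤ), ∀ t ∈ Icc (0 : ℝ) T, X i n t = ∫ ξ : EuclideanSpace ℝ (Fin 3),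
          duhamelScalar (A * modeDelta i₀ i n₀ n) (fun s => TaoCascade.quadTerm ε₀ α X i n (max s 0)) (heatRate ξ) t *
            modeWeight 𝒟 i n ξ) ∧
        ∃ C : ℝ, ∀ (i : Fin m) (n : ℤ), ∀ t ∈ Icc (0 : ℝ) T, (1 + ((1 + ε₀) ^ n) ^ 10) * |X i n t| ≤ C := by
      intro T
      by_cases hT : 0 ≤ T ∧ T < S
      · obtain ⟨T₁, hT₁, hTT₁⟩ := exists_lt_of_lt_csSup ⟨0, h0⟩ hT.2
        obtain ⟨-, X, hX⟩ := hdown T₁ hT₁ T ⟨hT.1, hTT₁.le⟩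
        exact ⟨X, fun _ => hX⟩
      · exact ⟨fun _ _ _ => 0, fun h => absurd h hT⟩
    choose Xf hXf using hmem
    -- glue on `[0,S)` along `σ(s) = (s+S)/2`
    have hσI : ∀ s ∈ Ico (0 : ℝ) S, 0 ≤ (s + S) / 2 ∧ (s + S) / 2 < S := fun s hs => ⟨by linarith [hs.1], by linarith [hs.2]⟩
    obtain ⟨hagree, hVY, hBY⟩ := volterra_glue hε₀ hε₁ 𝒟 α i₀ n₀ A (I := Ico (0 : ℝ) S) (σ := fun s => (s + S) / 2)
      (Xf := fun s => Xf ((s + S) / 2)) (fun s hs => ⟨hs.1, fun r hr => ⟨hr.1, hr.2.trans_lt hs.2⟩⟩)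
      (fun s hs => ⟨by linarith [hs.2], fun s' _ hs's => by linarith⟩) (fun s hs => (hXf _ (hσI s hs)).1)
      (fun s hs => (hXf _ (hσI s hs)).2.1) (fun s hs => (hXf _ (hσI s hs)).2.2)
    beta_reduce at hagree hVY hBY
    -- the energy bound along the glued solution, and the bound of its forcings
    have hYA : ∀ (i : Fin m) (n : ℤ), ∀ t ∈ Ico (0 : ℝ) S, |Xf ((t + S) / 2) i n t| ≤ |A| := by
      intro i n t ht
      obtain ⟨C, hC⟩ := (hXf _ (hσI t ht)).2.2
      exact abs_le_of_sol hε₀ hε₁ 𝒟 hcanc i₀ n₀ A (hXf _ (hσI t ht)).1 (hXf _ (hσI t ht)).2.1 hC i n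
        ⟨ht.1, by linarith [ht.2]⟩
    -- every mode is Lipschitz on `[0,S)` (its forcing is bounded by the energy bound), hence extends continuously
    have hlip : ∀ (i : Fin m) (n : ℤ), ∃ L : ℝ≥0, LipschitzOnWith L (fun t => Xf ((t + S) / 2) i n t) (Ico (0 : ℝ) S) := by
      intro i n
      set CQ : ℝ := (∑ i₁ : Fin m, ∑ i₂ : Fin m, ∑ μ ∈ TaoCascade.shiftSet, |α i₁ i₂ i μ|) *
        ((1 + ε₀) ^ ((5 : ℝ) * n / 2) * |A| ^ 2) with hCQ
      set L : ℝ≥0 := Real.toNNReal (modeRateBound ε₀ n * (|A * modeDelta i₀ i n₀ n| + S * CQ) + CQ) with hL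
      have key : ∀ r ∈ Ico (0 : ℝ) S, ∀ s ∈ Ico (0 : ℝ) S, r ≤ s →
          dist (Xf ((r + S) / 2) i n r) (Xf ((s + S) / 2) i n s) ≤ L * dist r s := by
        intro r hr s hs hrs
        have hσs := hσI s hs
        obtain ⟨hXc, hXV, C, hXC⟩ := hXf _ hσs
        -- the forcing of `X* = Xf (σ s)` is bounded by `CQ` on `[0,s]`
        have hQb : ∀ r' ∈ Icc (0 : ℝ) s, |TaoCascade.quadTerm ε₀ α (Xf ((s + S) / 2)) i n (max r' 0)| ≤ CQ := by
          intro r' hr'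
          rw [max_eq_left hr'.1]
          exact abs_quadTerm_le_of_abs_le α hε₀.le (fun j k => abs_le_of_sol hε₀ hε₁ 𝒟 hcanc i₀ n₀ A hXc hXV hXC j k
            ⟨hr'.1, hr'.2.trans_lt (by linarith [hs.2])⟩) i n
        have hLs := lipschitzOnWith_integral_duhamelScalar_modeWeight (𝒟 := 𝒟) (i := i) (n := n)
          (δ := A * modeDelta i₀ i n₀ n) hε (continuous_quadTerm_clamp α hXc i n) hQb
        have hrσ : r ∈ Icc (0 : ℝ) ((s + S) / 2) := ⟨hr.1, by linarith [hs.2]⟩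
        have hsσ : s ∈ Icc (0 : ℝ) ((s + S) / 2) := ⟨hs.1, by linarith [hs.2]⟩
        rw [hagree s hs r ⟨hr.1, hrs⟩ i n, hXV i n r hrσ, hXV i n s hsσ]
        refine (hLs.dist_le_mul r ⟨hr.1, hrs⟩ s ⟨hs.1, le_rfl⟩).trans (mul_le_mul_of_nonneg_right ?_ dist_nonneg)
        have hCQ0 : 0 ≤ CQ := by positivity
        have h1 : s * CQ ≤ S * CQ := mul_le_mul_of_nonneg_right hs.2.le hCQ0
        have h2 := mul_le_mul_of_nonneg_left (add_le_add_left h1 |A * modeDelta i₀ i n₀ n|) (modeRateBound_nonneg ε₀ n)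
        exact NNReal.coe_le_coe.2 (Real.toNNReal_le_toNNReal (by linarith))
      refine ⟨L, LipschitzOnWith.of_dist_le_mul fun r hr s hs => ?_⟩
      rcases le_total r s with hrs | hrs
      · exact key r hr s hs hrs
      · rw [dist_comm, dist_comm r]; exact key s hs r hr hrs
    choose L hL using hlip
    choose g hg using fun i n => (hL i n).extend_real
    have hgY : ∀ (i : Fin m) (n : ℤ), ∀ t ∈ Ico (0 : ℝ) S, Xf ((t + S) / 2) i n t = g i n t := fun i n t ht => (hg i n).2 ht
    refine ⟨S, hS0, g, fun i n => (hg i n).1.continuous, fun i n t ht => ?_, fun S' hS' => ?_, fun C => ?_⟩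
    · -- the Volterra identity on `[0,S)`
      rw [← hgY i n t ht, hVY i n t ht]
      refine integral_congr_ae (Eventually.of_forall fun ξ => ?_)
      simp only
      rw [duhamelScalar_congr ht.1 fun r hr => quadTerm_congr α (X := fun j k r' => Xf ((r' + S) / 2) j k r') (Y := g)
        (fun j k => hgY j k _ ⟨le_max_right _ _, (max_le hr.2 ht.1).trans_lt ht.2⟩) i n]
    · obtain ⟨C, hC⟩ := hBY S' hS'
      exact ⟨C, fun i n t ht => by rw [← hgY i n t ⟨ht.1, ht.2.trans_lt hS'.2⟩]; exact hC i n t ht⟩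
    · -- blow-up: a weighted bound up to `S` would let the Picard step pass `S`
      by_contra hcon
      push Not at hcon
      have hC0 : 0 ≤ C := le_trans (by positivity) (hcon 0 ⟨le_rfl, hS0⟩ i₀ n₀)
      have hYC : ∀ t ∈ Ico (0 : ℝ) S, ∀ (i : Fin m) (n : ℤ), (1 + ((1 + ε₀) ^ n) ^ 10) * |Xf ((t + S) / 2) i n t| ≤ C := by
        intro t ht i n
        rw [hgY i n t ht]
        exact (mul_le_mul_of_nonneg_right weight_le_weight' (abs_nonneg _)).trans (hcon t ht i n)
      set R₁ : ℝ := C + (1 + ((1 + ε₀) ^ n₀) ^ 10) * |A| + 2 ^ 22 * K * S * C ^ 2 + 1 with hR₁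
      set τ₁ : ℝ := 1 / (2 ^ 23 * K * R₁ ^ 2 + 1) with hτ₁
      have hτ₁0 : 0 < τ₁ := by positivity
      set T : ℝ := max 0 (S - τ₁ / 2) with hT
      have hT0 : 0 ≤ T := le_max_left _ _
      have hTS : T < S := max_lt hS0 (by linarith)
      obtain ⟨hXc, hXV, -⟩ := hXf _ (hσI T ⟨hT0, hTS⟩)
      have hmemT : T + τ₁ ∈ 𝒮 := by
        refine hstep T C R₁ τ₁ (Xf ((T + S) / 2)) hT0 hXc (fun i n t ht => hXV i n t ⟨ht.1, ht.2.trans (by linarith)⟩)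
          (fun i n t ht => ?_) ?_ hτ₁0 ?_
        · rw [← hagree T ⟨hT0, hTS⟩ t ht i n]
          exact hYC t ⟨ht.1, ht.2.trans_lt hTS⟩ i n
        · have : 2 ^ 22 * K * T * C ^ 2 ≤ 2 ^ 22 * K * S * C ^ 2 := by
            have := mul_le_mul_of_nonneg_left hTS.le (by positivity : (0 : ℝ) ≤ 2 ^ 22 * K * C ^ 2)
            nlinarith [this]
          linarith
        · rw [hτ₁, div_mul_eq_mul_div, one_mul, div_le_one (by positivity)]
          linarith
      have h1 : T + τ₁ ≤ S := le_csSup hbdd hmemT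
      have h2 : S - τ₁ / 2 ≤ T := le_max_right _ _
      linarith
  · -- (M1) a global solution
    left
    have hall : ∀ T : ℝ, ∃ X : Fin m → ℤ → ℝ → ℝ, 0 ≤ T → (∀ (i : Fin m) (n : ℤ), Continuous (X i n)) ∧
        (∀ (i : Fin m) (n : ℤ), ∀ t ∈ Icc (0 : ℝ) T, X i n t = ∫ ξ : EuclideanSpace ℝ (Fin 3),
          duhamelScalar (A * modeDelta i₀ i n₀ n) (fun s => TaoCascade.quadTerm ε₀ α X i n (max s 0)) (heatRate ξ) t *
            modeWeight 𝒟 i n ξ) ∧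
        ∃ C : ℝ, ∀ (i : Fin m) (n : ℤ), ∀ t ∈ Icc (0 : ℝ) T, (1 + ((1 + ε₀) ^ n) ^ 10) * |X i n t| ≤ C := by
      intro T
      by_cases hT : 0 ≤ T
      · obtain ⟨T₁, hT₁, hTT₁⟩ := not_bddAbove_iff.1 hbdd T
        obtain ⟨-, X, hX⟩ := hdown T₁ hT₁ T ⟨hT, hTT₁.le⟩
        exact ⟨X, fun _ => hX⟩
      · exact ⟨fun _ _ _ => 0, fun h => absurd h hT⟩
    choose Xf hXf using hall
    have hI1 : ∀ s ∈ Ici (0 : ℝ), (0 : ℝ) ≤ s + 1 := fun s hs => by linarith [mem_Ici.1 hs]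
    obtain ⟨hagree, hVY, hBY⟩ := volterra_glue hε₀ hε₁ 𝒟 α i₀ n₀ A (I := Ici (0 : ℝ)) (σ := fun s => s + 1)
      (Xf := fun s => Xf (s + 1)) (fun s hs => ⟨mem_Ici.1 hs, fun r hr => mem_Ici.2 hr.1⟩)
      (fun s hs => ⟨by linarith, fun s' _ hs's => by linarith⟩) (fun s hs => (hXf _ (hI1 s hs)).1)
      (fun s hs => (hXf _ (hI1 s hs)).2.1) (fun s hs => (hXf _ (hI1 s hs)).2.2)
    beta_reduce at hagree hVY hBY
    have hcont := fun i n => continuousOn_glue (I := Ici (0 : ℝ)) (Xf := fun s => Xf (s + 1)) (fun s hs => mem_Ici.1 hs)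
      (fun s hs => ⟨s + 1, mem_Ici.2 (by linarith [mem_Ici.1 hs]), by linarith⟩) (fun s hs => (hXf _ (hI1 s hs)).1) hagree i n
    refine ⟨fun i n t => Xf (max t 0 + 1) i n (max t 0), fun i n => ?_, fun i n t ht => ?_, fun S' hS' => ?_⟩
    · exact (hcont i n).comp_continuous (continuous_id.max continuous_const) fun t => mem_Ici.2 (le_max_right t 0)
    · have hQ : ∀ r : ℝ, TaoCascade.quadTerm ε₀ α (fun j k r' => Xf (max r' 0 + 1) j k (max r' 0)) i n (max r 0) =
          TaoCascade.quadTerm ε₀ α (fun j k r' => Xf (r' + 1) j k r') i n (max r 0) :=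
        fun r => quadTerm_congr α (fun j k => by simp only [max_eq_left (le_max_right r 0)]) i n
      simp only [max_eq_left (mem_Ici.1 ht), hQ]
      exact hVY i n t ht
    · obtain ⟨C, hC⟩ := hBY S' hS'
      exact ⟨C, fun i n t ht => by simp only [max_eq_left ht.1]; exact hC i n t ht⟩

end Summit.NavierStokesRegularity.NavierStokesRegularity.Theorems.PerpetualPumpPumpTransfer

end
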